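import Literature.MathematicalPhysics.QuantumFieldTheory.Balaban1983to89.B4Lower18RegularRegion

/-!
# `Balaban1983to89.B4Prop31Holonomy` — T. Bałaban, *Regularity and decay of lattice Green's functions*, Commun. Math.
Phys. **89** (1983) 571–597 [Balaban1983RegularityDecay] (= [B4]): «Proposition 3.1′ of [2]» (1.21)–(1.22) p. 574 at
`A ≠ 0` — file 2b/3: the PRISMS `Γ_{y,x} ∪ [x, x + e_μ] ∪ Γ_{y′,x′} ∪ ⟨y′, y⟩` of §4 (p. 590: the contours of
(4.8)–(4.10))
for [B4]'s abelian link variables `U(A_b) = exp(qeηA_b)` (1.2), their HOLONOMY, and its bound from the regularity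
(1.21) `|(∂^η_μA)(x)| ≤ O(1)p(e)`

statement-level skeleton of published theorems with citation tags; proofs where landed; nothing here is a claim about
the Yang–Mills mass gap

PDF held: `paper:balaban1983-cmp89-regularity-decay` (journal page = PDF page + 570); pp. 572–574 [PDF 2–4], 589–591
[PDF 19–21] read.

CITATION HEADER (lean-in-tree rule).  Phase-2 PROOF file of the lit-balaban typed skeleton (HOME
`run/shared/lean/pub/lit-balaban/`), SKELETON row **`B4.Prop3.1'[II]`** (owner r01, referee ref-4), seat p35 gen 2 (unit
`lit-balaban-p35`); file 1 = `B4Prop31Energy` (generic variational representation (4.1)–(4.3)), file 2a =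
`B4Prop31Prism` (abelian telescoping / prism inequality), file 3 = `B4Prop31Averaging` + `B4Prop31Regular` (the
covariant averaging inequality, (1.22), and the typed leaf `B4.Prop31Printed` on the regular-region family).

THE PRINTED TEXT (p. 590 [PDF 20], verbatim up to OCR, `≦` written `≤`): *"Now it is easily seen that to prove (1.18) it
is sufficient to prove a_k|φ(x)|² + a_k|φ(x′)|² − a_k²⟨φ, Q_k(A)G_k(Δ(x,x′),A)Q_k^*(A)φ⟩ ≥ γ₀′|U(A(⟨x,x′⟩))φ(x′) −
φ(x)|² −
O(1)e²p²(e)(|φ(x)|² + |φ(x′)|²), (4.7) with γ₀′ independent of k, ⟨x,x′⟩, and A. … Using the regularity condition for A,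
we write A = A₀ + A′ on Δ(x,x′) with A₀ constant and A′ satisfying the bounds |A′|, |∂^η_μA′| ≤ O(1)p(e)."* and the
contours of (4.8): *"Σ_{y=x,x′} Σ_{z∈B^k(y)} η^d eηA′(Γ^{(k)}_{y,z}) q U(A₀(Γ^{(k)}_{y,z}))φ^{(k)}(z)"*.  DICTIONARY
(lattice units, as `B4Lower18RegularRegion`): `η = 1/n`; the fine region of the unit labels `Ωc ⊂ ℤ^{d+1}` is
`fineDom n Ωc`; `Γ^{(k)}_{y,x}` = the staircase `stair (n·y) x` (`rstairContour`); the unit-lattice bond `⟨y, y + e_μ⟩`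
is the straight fine contour `seg μ (n·y) n` of `n` steps; a vector field in component form `A_ν(x)` is the bond
function `compField`; `U(A(Γ)) = F.U(κ·Σ_{b⊂Γ}A_b)` (`transport_fieldLink`, `κ = eη = e/n`); (1.21) reads
`|A_ν(x + e_μ) − A_ν(x)| ≤ δ`, `δ = O(1)p(e)·η`.

WHAT IS KERNEL-CHECKED (zero `sorry`, standard axioms; no new `Prop`-valued statement):
* §1 the contour sums `A(Γ_{y,x})` (`stairSum`), `A(⟨y, y+e_μ⟩)` and `A([x, x + e_μ])` (`segSum`), the transporters of
  the region in closed form (`contourTrans_region_eq`: `U(A(Γ_{y,x})) = F.U(κ·A(Γ_{y,x}))`), the unit-lattice link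
  `U(A(⟨y,y+e_μ⟩))` of (1.22) (`clink`, `clink_eq`, orthogonal);
* §2 translation covariance of the staircases (`stair_add`: `Γ_{y+e_μ, x+e_μ} = Γ_{y,x} + e_μ`), the HOLONOMY SUM of
  the prism `Λ(y,μ,x) = A(⟨y,y′⟩) + A(Γ_{y′,x′}) − A(Γ_{y,x}) − A([x,x′])` (`loopSum`) and its bound from (1.21):
  **`abs_loopSum_le`: `|Λ| ≤ (3d+4)·n²·δ`** (`= (3d+4)·O(1)p(e)/η … ×η²`: with `κ = e/n`, `|κΛ| ≤ (3d+4)·O(1)·e·p(e)`,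
  the source of the printed `O(1)e²p²(e)` in (4.7)/(1.22));
(The abelian PRISM INEQUALITY that consumes `κΛ` is `B4Prop31Prism.prism_sq_le`, file 2a.)
Unit `lit-balaban-p35` (gen 2), HOME as above.
-/

namespace Literature.MathematicalPhysics.QuantumFieldTheory.Balaban1983to89.B4Prop31Holonomy

open Matrix Finset
open Literature.MathematicalPhysics.QuantumFieldTheory.Balaban1983to89.B4GaugeCovariance
open Literature.MathematicalPhysics.QuantumFieldTheory.Balaban1983to89.B4Lower18Regular
  (dotProduct_self_nonneg' orth_dotProduct_mulVec_self sum_smul_dotProduct_self_le PathRel lsum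
    transport_fieldLink abs_lsum_le e1 e1_apply_self e1_apply_ne add_nsmul_e1_apply seg length_seg pathEnd_seg
    mem_seg raise raise_apply_self raise_apply_ne le_raise raise_le stairL stair pathEnd_stair length_stair_le
    mem_stair base_le_of_blk pathRel_append pathEnd_seg_raise)
open Literature.MathematicalPhysics.QuantumFieldTheory.Balaban1983to89.B4Lower18RegularRegion
  (compField compField_add compField_sub rbaseEmb rstairContour abs_comp_sub_base_le blk_of_between
    stair_mem_fineDom pathRel_and pathRel_chain abs_sub_le_of_pathRel pathRel_stairL_up)
open Literature.MathematicalPhysics.QuantumFieldTheory.Balaban1983to89.B4Reflection242 (nbrs blk mem_nbrs blk_mul)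
open Literature.MathematicalPhysics.QuantumFieldTheory.Balaban1983to89.B4Lower18 (fineDom mem_fineDom)
open Literature.MathematicalPhysics.QuantumFieldTheory.Balaban1983to89.B4BoxCov237
  (finePt_apply blk_finePt finePt_injective)
open B4Green244 (finePt)

noncomputable section

section Lattice

/-! ## §1  Contour sums and transporters of a region of unit blocks, in closed form -/

variable {ι : Type*} [Fintype ι] [DecidableEq ι] {d : ℕ}

/-- the base corner `n·y ∈ ηℤ^{d+1}` (lattice units) of the unit block `B(y)` — [B4]'s `y ∈ Z^d ⊂ ηZ^d`, the start of
`Γ^{(k)}_{y,x}`. [cite: Balaban1983RegularityDecay, p. 572 (1.4), dictionary] -/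
def base (n : ℕ) (y : Fin (d + 1) → ℤ) : Fin (d + 1) → ℤ := fun i => (n : ℤ) * y i

/-- `n·(y + e_μ) = n·y + n·e_μ`. [cite: Balaban1983RegularityDecay, p. 590 (4.8), geometry of the contours Γ_{y,x}
(algebra)] -/
theorem base_add_e1 (n : ℕ) (y : Fin (d + 1) → ℤ) (μ : Fin (d + 1)) :
    base n (y + e1 μ) = base n y + n • e1 μ := by
  funext k
  simp only [base, Pi.add_apply, Pi.smul_apply]
  by_cases hk : k = μ
  · subst hk; rw [e1_apply_self]; ring
  · rw [e1_apply_ne hk]; ring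

/-- chart shift: `finePt n (y + e_μ) j = finePt n y j + n·e_μ`. [cite: Balaban1983RegularityDecay, p. 590 (4.8),
geometry of the contours Γ_{y,x} (algebra)] -/
theorem finePt_add_e1 (n : ℕ) (y : Fin (d + 1) → ℤ) (μ : Fin (d + 1)) (j : Fin (d + 1) → Fin n) :
    finePt n (y + e1 μ) j = finePt n y j + n • e1 μ := by
  funext k
  simp only [finePt_apply, Pi.add_apply, Pi.smul_apply]
  by_cases hk : k = μ
  · subst hk; rw [e1_apply_self]; ring
  · rw [e1_apply_ne hk]; ring

/-- **`A(Γ^{(k)}_{y,x})`**: the contour sum of the vector field `A_ν` (component form) along the staircase `Γ_{y,x}`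
from
the base corner `n·y` to `x` («A(Γ) = Σ_{b⊂Γ} A_b»). [cite: Balaban1983RegularityDecay, p. 572 (1.4)] -/
def stairSum (Ac : (Fin (d + 1) → ℤ) → Fin (d + 1) → ℝ) (n : ℕ) (y x : Fin (d + 1) → ℤ) : ℝ :=
  lsum (compField Ac) (base n y) (stair (base n y) x)

/-- **`A([p, p + m·e_μ])`**: the contour sum along the straight contour of `m` steps in direction `μ` from `p` — for
`p = n·y`, `m = n` this is `A(⟨y, y + e_μ⟩)` of (1.22), for `p = x ∈ B(y)` it is `A` along `[x, x + e_μ]`.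
[cite: Balaban1983RegularityDecay, p. 572 «A(Γ) = Σ_{b⊂Γ} A_b», p. 574 (1.22)] -/
def segSum (Ac : (Fin (d + 1) → ℤ) → Fin (d + 1) → ℝ) (μ : Fin (d + 1)) (p : Fin (d + 1) → ℤ) (m : ℕ) : ℝ :=
  lsum (compField Ac) p (seg μ p m)

/-- the straight contour sum is `Σ_{i<m} A_μ(p + i·e_μ)`. [cite: Balaban1983RegularityDecay, p. 572 «A(Γ) = Σ_{b⊂Γ}
A_b»] -/
theorem segSum_eq_sum (Ac : (Fin (d + 1) → ℤ) → Fin (d + 1) → ℝ) (μ : Fin (d + 1)) (p : Fin (d + 1) → ℤ) (m : ℕ) :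
    segSum Ac μ p m = ∑ i ∈ range m, Ac (p + i • e1 μ) μ := by
  unfold segSum
  induction m generalizing p with
  | zero => simp [seg, lsum]
  | succ m ih =>
      rw [seg, lsum, compField_add, ih, Finset.sum_range_succ', zero_smul, add_zero, add_comm]
      congr 1
      refine Finset.sum_congr rfl fun i _ => ?_
      rw [succ_nsmul', add_assoc, add_comm (e1 μ)]

/-- transport of a contour of subtype points is the transport of the underlying contour. [cite:
Balaban1983RegularityDecay, p. 590 (4.8), geometry of the contours Γ_{y,x} (algebra)] -/
theorem transport_pmap {X : Type*} {P : X → Prop} (W : X → X → Matrix ι ι ℝ) (l : List X) (p : X) (hp : P p)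
    (h : ∀ z ∈ l, P z) :
    transport (fun u v : Subtype P => W u.1 v.1) ⟨p, hp⟩ (l.pmap Subtype.mk h) = transport W p l := by
  induction l generalizing p with
  | nil => rfl
  | cons a l ih =>
      show W p a * transport (fun u v : Subtype P => W u.1 v.1) ⟨a, _⟩ (l.pmap Subtype.mk _) = W p a * transport W a l
      rw [ih]

/-- **THE TRANSPORTERS OF THE REGION IN CLOSED FORM**: for [B4]'s abelian link variables `U(A_b) = F.U(κA_b)` on the
region `fineDom n Ωc` with the staircase contours, `U(A(Γ_{y,x})) = F.U(κ·A(Γ_{y,x}))` at every `x ∈ B(y)`.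
[cite: Balaban1983RegularityDecay, p. 572 (1.2), (1.4)] -/
theorem contourTrans_region_eq (F : OrthFlow ι) (κ : ℝ) {n : ℕ} (hn : 1 ≤ n) (Ωc : Finset (Fin (d + 1) → ℤ))
    (Ac : (Fin (d + 1) → ℤ) → Fin (d + 1) → ℝ) (y : ↥Ωc) (x : ↥(fineDom n Ωc)) (hx : blk n x.1 = y.1) :
    contourTrans (fieldLink F κ (fun u v : ↥(fineDom n Ωc) => compField Ac u.1 v.1)) (rbaseEmb hn Ωc)
        (rstairContour hn Ωc) y x
      = F.U (κ * stairSum Ac n y.1 x.1) := by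
  rw [contourTrans, rstairContour, dif_pos hx, stairSum, ← transport_fieldLink]
  exact transport_pmap (fieldLink F κ (compField Ac)) _ _ _ _

/-- **THE UNIT-LATTICE LINK `U(A(⟨y, y + e_μ⟩))` OF (1.22)**: the transport along the straight fine contour of `n` steps
from `n·y` to `n·(y + e_μ)` (the bond `⟨y, y+e_μ⟩` of `Ω^{(k)} ⊂ Z^d` as a contour of `ηZ^d`).
[cite: Balaban1983RegularityDecay, p. 574 (1.22)] -/
def clink (F : OrthFlow ι) (κ : ℝ) (Ac : (Fin (d + 1) → ℤ) → Fin (d + 1) → ℝ) (n : ℕ) (y : Fin (d + 1) → ℤ)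
    (μ : Fin (d + 1)) : Matrix ι ι ℝ :=
  transport (fieldLink F κ (compField Ac)) (base n y) (seg μ (base n y) n)

/-- closed form of the unit-lattice link: `U(A(⟨y, y+e_μ⟩)) = F.U(κ·A(⟨y, y+e_μ⟩))`.
[cite: Balaban1983RegularityDecay, p. 572 (1.2), p. 574 (1.22)] -/
theorem clink_eq (F : OrthFlow ι) (κ : ℝ) (Ac : (Fin (d + 1) → ℤ) → Fin (d + 1) → ℝ) (n : ℕ)
    (y : Fin (d + 1) → ℤ) (μ : Fin (d + 1)) :
    clink F κ Ac n y μ = F.U (κ * segSum Ac μ (base n y) n) := by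
  rw [clink, transport_fieldLink, segSum]

/-- the unit-lattice link is orthogonal. [cite: Balaban1983RegularityDecay, p. 572 (1.2)] -/
theorem clink_orth (F : OrthFlow ι) (κ : ℝ) (Ac : (Fin (d + 1) → ℤ) → Fin (d + 1) → ℝ) (n : ℕ)
    (y : Fin (d + 1) → ℤ) (μ : Fin (d + 1)) : (clink F κ Ac n y μ)ᵀ * clink F κ Ac n y μ = 1 := by
  rw [clink_eq]
  exact F.orth _

/-! ## §2  Translation of the staircases, the holonomy sum of a prism and its bound from (1.21) -/

/-- segments translate. [cite: Balaban1983RegularityDecay, p. 590 (4.8), geometry of the contours Γ_{y,x} (algebra)] -/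
theorem seg_add (i : Fin (d + 1)) (p v : Fin (d + 1) → ℤ) (m : ℕ) :
    seg i (p + v) m = (seg i p m).map (· + v) := by
  induction m generalizing p with
  | zero => rfl
  | succ m ih =>
      rw [seg, seg, List.map_cons, add_right_comm p v (e1 i), ih]

/-- raising a coordinate commutes with translation. [cite: Balaban1983RegularityDecay, p. 590 (4.8), geometry of the
contours Γ_{y,x} (algebra)] -/
theorem raise_add (x p v : Fin (d + 1) → ℤ) (i : Fin (d + 1)) : raise (x + v) (p + v) i = raise x p i + v := by
  unfold raise
  simp only [Pi.add_apply, add_sub_add_right_eq_sub]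
  rw [add_right_comm]

/-- staircases through a coordinate list translate. [cite: Balaban1983RegularityDecay, p. 590 (4.8), geometry of the
contours Γ_{y,x} (algebra)] -/
theorem stairL_add (x v : Fin (d + 1) → ℤ) (cs : List (Fin (d + 1))) :
    ∀ p, stairL (x + v) (p + v) cs = (stairL x p cs).map (· + v) := by
  induction cs with
  | nil => intro p; rfl
  | cons i cs ih =>
      intro p
      rw [stairL, stairL, List.map_append, ← seg_add, ← ih, raise_add]
      simp only [Pi.add_apply, add_sub_add_right_eq_sub]

/-- **THE STAIRCASES ARE TRANSLATION COVARIANT**: `Γ_{u + v, x + v} = Γ_{u,x} + v` (so `Γ_{y+e_μ, x+e_μ}` is the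
translate of `Γ_{y,x}` by the unit bond, the top face of the prism). [cite: Balaban1983RegularityDecay, p. 590 (4.8),
geometry of the contours Γ_{y,x} (algebra)] -/
theorem stair_add (u x v : Fin (d + 1) → ℤ) : stair (u + v) (x + v) = (stair u x).map (· + v) :=
  stairL_add x v _ u

/-- a contour sum along a translated contour is the contour sum of the translated bond function. [cite:
Balaban1983RegularityDecay, p. 590 (4.8), geometry of the contours Γ_{y,x} (algebra)] -/
theorem lsum_map_add (B : (Fin (d + 1) → ℤ) → (Fin (d + 1) → ℤ) → ℝ) (v : Fin (d + 1) → ℤ)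
    (l : List (Fin (d + 1) → ℤ)) :
    ∀ p, lsum B (p + v) (l.map (· + v)) = lsum (fun a b => B (a + v) (b + v)) p l := by
  induction l with
  | nil => intro p; rfl
  | cons a l ih => intro p; rw [List.map_cons, lsum, lsum, ih]

/-- contour sums are additive in the bond function. [cite: Balaban1983RegularityDecay, p. 590 (4.8), geometry of the
contours Γ_{y,x} (algebra)] -/
theorem lsum_sub {X : Type*} (B₁ B₂ : X → X → ℝ) (l : List X) :
    ∀ p, lsum (fun a b => B₁ a b - B₂ a b) p l = lsum B₁ p l - lsum B₂ p l := by
  induction l with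
  | nil => intro p; simp [lsum]
  | cons a l ih => intro p; rw [lsum, lsum, lsum, ih]; ring

/-- the points `n·y + i·e_μ`, `i < n`, of the bottom straight face are chart points of `B(y)`. [cite:
Balaban1983RegularityDecay, p. 590 (4.8), geometry of the contours Γ_{y,x} (algebra)] -/
theorem base_add_nsmul_eq_finePt {n : ℕ} (hn : 1 ≤ n) (y : Fin (d + 1) → ℤ) (μ : Fin (d + 1)) {i : ℕ}
    (hi : i < n) :
    base n y + i • e1 μ = finePt n y (fun k => if k = μ then ⟨i, hi⟩ else ⟨0, hn⟩) := by
  funext k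
  rw [add_nsmul_e1_apply, finePt_apply]
  by_cases hk : k = μ
  · subst hk; simp [base]
  · simp [base, hk]

/-- hence they lie in `B(y)`. [cite: Balaban1983RegularityDecay, p. 590 (4.8), geometry of the contours Γ_{y,x}
(algebra)] -/
theorem blk_base_add_nsmul {n : ℕ} (hn : 1 ≤ n) (y : Fin (d + 1) → ℤ) (μ : Fin (d + 1)) {i : ℕ} (hi : i < n) :
    blk n (base n y + i • e1 μ) = y := by
  rw [base_add_nsmul_eq_finePt hn y μ hi, blk_finePt hn]

/-- **THE HOLONOMY SUM OF THE PRISM over the unit bond `⟨y, y + e_μ⟩` through `x ∈ B(y)`**: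
`Λ = A(⟨y, y+e_μ⟩) + A(Γ_{y+e_μ, x+e_μ}) − A(Γ_{y,x}) − A([x, x+e_μ])`, the oriented sum of `A` around the closed
contour `n·y → x → x + n·e_μ → n·(y+e_μ) → n·y` (for the abelian (1.2), `U` around it `= F.U(κΛ)`).
[cite: Balaban1983RegularityDecay, p. 590 (4.8)–(4.10), dictionary] -/
def loopSum (Ac : (Fin (d + 1) → ℤ) → Fin (d + 1) → ℝ) (n : ℕ) (y : Fin (d + 1) → ℤ) (μ : Fin (d + 1))
    (x : Fin (d + 1) → ℤ) : ℝ :=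
  segSum Ac μ (base n y) n + stairSum Ac n (y + e1 μ) (x + n • e1 μ) - stairSum Ac n y x - segSum Ac μ x n

/-- block geometry along the prism: for `x ∈ B(y)` and `t ≤ n`, `x + t·e_μ ∈ B(y) ∪ B(y + e_μ)`. [cite:
Balaban1983RegularityDecay, p. 590 (4.8), geometry of the contours Γ_{y,x} (algebra)] -/
theorem blk_add_nsmul_e1 {n : ℕ} (hn : 1 ≤ n) {x y : Fin (d + 1) → ℤ} (hx : blk n x = y) (μ : Fin (d + 1))
    {t : ℕ} (ht : t ≤ n) : blk n (x + t • e1 μ) = y ∨ blk n (x + t • e1 μ) = y + e1 μ := by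
  have hn0 : (0 : ℤ) < n := by exact_mod_cast hn
  have h1 : (n : ℤ) * y μ ≤ x μ := (base_le_of_blk hn hx).1 μ
  have h2 : x μ < n * (y μ + 1) := by
    have hq : x μ / (n : ℤ) = y μ := congrFun hx μ
    have := Int.mul_ediv_add_emod (x μ) (n : ℤ)
    have := Int.emod_lt_of_pos (x μ) hn0
    rw [hq] at *
    linarith
  have hother : ∀ k, k ≠ μ → (x + t • e1 μ) k / (n : ℤ) = y k := by
    intro k hk
    rw [add_nsmul_e1_apply, if_neg hk, ← hx]
    rfl
  have ht' : (t : ℤ) ≤ n := by exact_mod_cast ht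
  by_cases hc : x μ + t < n * (y μ + 1)
  · left
    funext k
    by_cases hk : k = μ
    · subst hk
      show (x + t • e1 k) k / (n : ℤ) = y k
      rw [add_nsmul_e1_apply, if_pos rfl]
      apply le_antisymm
      · exact Int.lt_add_one_iff.1 ((Int.ediv_lt_iff_lt_mul hn0).2 (by linarith))
      · exact (Int.le_ediv_iff_mul_le hn0).2 (by linarith)
    · exact hother k hk
  · right
    have hc' : (n : ℤ) * (y μ + 1) ≤ x μ + t := not_lt.1 hc
    funext k
    by_cases hk : k = μ
    · subst hk
      show (x + t • e1 k) k / (n : ℤ) = (y + e1 k) k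
      rw [add_nsmul_e1_apply, if_pos rfl, Pi.add_apply, e1_apply_self]
      apply le_antisymm
      · exact Int.lt_add_one_iff.1 ((Int.ediv_lt_iff_lt_mul hn0).2 (by linarith))
      · exact (Int.le_ediv_iff_mul_le hn0).2 (by linarith)
    · show (x + t • e1 μ) k / (n : ℤ) = (y + e1 μ) k
      rw [hother k hk, Pi.add_apply, e1_apply_ne hk, add_zero]

/-- hence the prism stays in the region when both unit labels are in `Ωc`. [cite: Balaban1983RegularityDecay, p. 590
(4.8), geometry of the contours Γ_{y,x} (algebra)] -/
theorem add_nsmul_e1_mem_fineDom {n : ℕ} (hn : 1 ≤ n) {Ωc : Finset (Fin (d + 1) → ℤ)} {x y : Fin (d + 1) → ℤ}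
    (hx : blk n x = y) (hy : y ∈ Ωc) {μ : Fin (d + 1)} (hy' : y + e1 μ ∈ Ωc) {t : ℕ} (ht : t ≤ n) :
    x + t • e1 μ ∈ fineDom n Ωc := by
  rw [mem_fineDom hn]
  rcases blk_add_nsmul_e1 hn hx μ ht with h | h <;> rw [h]
  exacts [hy, hy']

/-- **(1.21) ALONG A STRAIGHT CONTOUR** (telescoping): `|A_ν(z + m·e_μ) − A_ν(z)| ≤ m·δ` when the `m` difference
points lie in the region. [cite: Balaban1983RegularityDecay, p. 574 (1.21)] -/
theorem abs_sub_nsmul_le {n : ℕ} (Ωc : Finset (Fin (d + 1) → ℤ)) {Ac : (Fin (d + 1) → ℤ) → Fin (d + 1) → ℝ}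
    {δ : ℝ} (h121 : ∀ x ∈ fineDom n Ωc, ∀ μ ν : Fin (d + 1), |Ac (x + e1 μ) ν - Ac x ν| ≤ δ)
    (z : Fin (d + 1) → ℤ) (μ ν : Fin (d + 1)) (m : ℕ) (hmem : ∀ t : ℕ, t < m → z + t • e1 μ ∈ fineDom n Ωc) :
    |Ac (z + m • e1 μ) ν - Ac z ν| ≤ m * δ := by
  induction m with
  | zero => simp
  | succ m ih =>
      have hm := h121 _ (hmem m (Nat.lt_succ_self m)) μ ν
      have ih' := ih fun t ht => hmem t (Nat.lt_succ_of_lt ht)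
      rw [succ_nsmul, ← add_assoc, Nat.cast_succ, add_mul, one_mul]
      calc |Ac (z + m • e1 μ + e1 μ) ν - Ac z ν|
          ≤ |Ac (z + m • e1 μ + e1 μ) ν - Ac (z + m • e1 μ) ν| + |Ac (z + m • e1 μ) ν - Ac z ν| := abs_sub_le _ _ _
        _ ≤ δ + m * δ := add_le_add hm ih'
        _ = m * δ + δ := add_comm _ _

/-- **THE TOP FACE MINUS THE BOTTOM FACE**: `|A(Γ_{y+e_μ, x+e_μ}) − A(Γ_{y,x})| ≤ (d+1)·n·(n·δ)` — bond by bond the two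
staircases differ by `A_ν(b + n·e_μ) − A_ν(b)`, `≤ nδ` by (1.21), over `≤ (d+1)n` bonds.
[cite: Balaban1983RegularityDecay, p. 574 (1.21), p. 590 (4.8)–(4.10)] -/
theorem abs_stairSum_shift_sub_le {n : ℕ} (hn : 1 ≤ n) {Ωc : Finset (Fin (d + 1) → ℤ)}
    {Ac : (Fin (d + 1) → ℤ) → Fin (d + 1) → ℝ} {δ : ℝ} (hδ : 0 ≤ δ)
    (h121 : ∀ x ∈ fineDom n Ωc, ∀ μ ν : Fin (d + 1), |Ac (x + e1 μ) ν - Ac x ν| ≤ δ)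
    {x y : Fin (d + 1) → ℤ} (hx : blk n x = y) (hy : y ∈ Ωc) {μ : Fin (d + 1)} (hy' : y + e1 μ ∈ Ωc) :
    |stairSum Ac n (y + e1 μ) (x + n • e1 μ) - stairSum Ac n y x| ≤ (d + 1) * n * (n * δ) := by
  set v : Fin (d + 1) → ℤ := n • e1 μ with hv
  have hbase := base_le_of_blk hn hx
  -- the two staircases, bond function of the difference
  have hshift : stairSum Ac n (y + e1 μ) (x + v)
      = lsum (fun a b => compField Ac (a + v) (b + v)) (base n y) (stair (base n y) x) := by
    rw [stairSum, base_add_e1, ← hv, stair_add, lsum_map_add]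
  have hdiff : stairSum Ac n (y + e1 μ) (x + v) - stairSum Ac n y x
      = lsum (fun a b => compField Ac (a + v) (b + v) - compField Ac a b) (base n y) (stair (base n y) x) := by
    rw [hshift, stairSum, lsum_sub]
  -- the step relation of the staircase: up-steps inside `B(y)`
  have hpath : PathRel (fun p q : Fin (d + 1) → ℤ => blk n p = y ∧ ((∃ ν, q = p + e1 ν) ∧ blk n q = y))
      (base n y) (stair (base n y) x) := by
    have h1 : PathRel (fun p q : Fin (d + 1) → ℤ => (∃ ν, q = p + e1 ν) ∧ blk n q = y)
        (base n y) (stair (base n y) x) :=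
      pathRel_and (r := fun p q : Fin (d + 1) → ℤ => ∃ ν, q = p + e1 ν) (P := fun q => blk n q = y) _ _
        (pathRel_stairL_up x _ _)
        (fun z hz => blk_of_between hn hx (mem_stair hbase.1 hz).1 (mem_stair hbase.1 hz).2)
    exact pathRel_chain (r := fun p q : Fin (d + 1) → ℤ => ∃ ν, q = p + e1 ν) (P := fun q => blk n q = y) _ _
      (blk_mul hn y) h1
  -- bondwise bound
  have hstep : ∀ p q : Fin (d + 1) → ℤ, (blk n p = y ∧ ((∃ ν, q = p + e1 ν) ∧ blk n q = y)) →
      |1 * (compField Ac (p + v) (q + v) - compField Ac p q)| ≤ n * δ := by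
    rintro p q ⟨hp, ⟨ν, rfl⟩, -⟩
    rw [one_mul, show p + e1 ν + v = (p + v) + e1 ν from add_right_comm _ _ _, compField_add, compField_add, hv]
    exact abs_sub_nsmul_le Ωc h121 p μ ν n fun t ht => add_nsmul_e1_mem_fineDom hn hp hy hy' ht.le
  have h := abs_lsum_le (κ := (1 : ℝ)) hstep _ _ hpath
  rw [one_mul] at h
  have hlen : ((stair (base n y) x).length : ℝ) ≤ (d + 1) * n := by
    have := length_stair_le hbase.1 hbase.2
    exact_mod_cast this
  rw [hdiff]
  exact h.trans (mul_le_mul_of_nonneg_right hlen (by positivity))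

/-- **THE TWO STRAIGHT FACES**: `|A(⟨y, y+e_μ⟩) − A([x, x+e_μ])| ≤ (2d+3)·n·(n·δ)` for `x ∈ B(y)` — termwise
`|A_μ(n·y + i·e_μ) − A_μ(x + i·e_μ)| ≤ (2(d+1) + 1)nδ` through the base corners of the blocks of the two points.
[cite: Balaban1983RegularityDecay, p. 574 (1.21), p. 590 (4.8)–(4.10)] -/
theorem abs_segSum_sub_le {n : ℕ} (hn : 1 ≤ n) {Ωc : Finset (Fin (d + 1) → ℤ)}
    {Ac : (Fin (d + 1) → ℤ) → Fin (d + 1) → ℝ} {δ : ℝ} (hδ : 0 ≤ δ)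
    (h121 : ∀ x ∈ fineDom n Ωc, ∀ μ ν : Fin (d + 1), |Ac (x + e1 μ) ν - Ac x ν| ≤ δ)
    {x y : Fin (d + 1) → ℤ} (hx : blk n x = y) (hy : y ∈ Ωc) {μ : Fin (d + 1)} (hy' : y + e1 μ ∈ Ωc) :
    |segSum Ac μ (base n y) n - segSum Ac μ x n| ≤ (2 * d + 3) * n * (n * δ) := by
  rw [segSum_eq_sum, segSum_eq_sum, ← Finset.sum_sub_distrib]
  have hterm : ∀ i ∈ range n, |Ac (base n y + i • e1 μ) μ - Ac (x + i • e1 μ) μ| ≤ (2 * d + 3) * (n * δ) := by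
    intro i hi
    have hi' : i < n := Finset.mem_range.1 hi
    -- the two points and their blocks
    have hb1 : blk n (base n y + i • e1 μ) = y := blk_base_add_nsmul hn y μ hi'
    have hm1 : base n y + i • e1 μ ∈ fineDom n Ωc := by rw [mem_fineDom hn, hb1]; exact hy
    have hm2 : x + i • e1 μ ∈ fineDom n Ωc := add_nsmul_e1_mem_fineDom hn hx hy hy' hi'.le
    have hD : 0 ≤ (d + 1 : ℝ) * n * δ := by positivity
    -- distances to the base corners
    have e1' := abs_comp_sub_base_le hn Ωc hδ h121 hm1 μ
    have e2' := abs_comp_sub_base_le hn Ωc hδ h121 hm2 μ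
    rw [hb1] at e1'
    have hbase_y : (fun k => (n : ℤ) * y k) = base n y := rfl
    rw [hbase_y] at e1'
    -- the base corner of the block of `x + i e_μ` is `n·y` or `n·y + n·e_μ`
    have e3 : |Ac (fun k => (n : ℤ) * blk n (x + i • e1 μ) k) μ - Ac (base n y) μ| ≤ n * δ := by
      rcases blk_add_nsmul_e1 hn hx μ hi'.le with h | h
      · rw [h, hbase_y, sub_self, abs_zero]; positivity
      · rw [h, show (fun k => (n : ℤ) * (y + e1 μ) k) = base n (y + e1 μ) from rfl, base_add_e1]
        exact abs_sub_nsmul_le Ωc h121 (base n y) μ μ n fun t ht =>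
          add_nsmul_e1_mem_fineDom hn (blk_mul hn y) hy hy' ht.le
    calc |Ac (base n y + i • e1 μ) μ - Ac (x + i • e1 μ) μ|
        ≤ |Ac (base n y + i • e1 μ) μ - Ac (base n y) μ|
          + |Ac (base n y) μ - Ac (x + i • e1 μ) μ| := abs_sub_le _ _ _
      _ ≤ (d + 1) * n * δ + (|Ac (base n y) μ - Ac (fun k => (n : ℤ) * blk n (x + i • e1 μ) k) μ|
          + |Ac (fun k => (n : ℤ) * blk n (x + i • e1 μ) k) μ - Ac (x + i • e1 μ) μ|) :=
          add_le_add e1' (abs_sub_le _ _ _)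
      _ ≤ (d + 1) * n * δ + (n * δ + (d + 1) * n * δ) := by
          rw [abs_sub_comm] at e3
          rw [abs_sub_comm] at e2'
          exact add_le_add le_rfl (add_le_add e3 e2')
      _ = (2 * d + 3) * (n * δ) := by ring
  calc |∑ i ∈ range n, (Ac (base n y + i • e1 μ) μ - Ac (x + i • e1 μ) μ)|
      ≤ ∑ i ∈ range n, |Ac (base n y + i • e1 μ) μ - Ac (x + i • e1 μ) μ| := Finset.abs_sum_le_sum_abs _ _
    _ ≤ ∑ _i ∈ range n, (2 * d + 3) * (n * δ) := Finset.sum_le_sum hterm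
    _ = (2 * d + 3) * n * (n * δ) := by rw [Finset.sum_const, Finset.card_range, nsmul_eq_mul]; ring

/-- **THE HOLONOMY OF A PRISM IS SMALL UNDER (1.21)**: `|Λ(y, μ, x)| ≤ (3d+4)·n²·δ` for `x ∈ B(y)`, `y, y + e_μ ∈
Ω^{(k)}`.
With `κ = eη = e/n` and `δ = O(1)p(e)·η` this is `|κΛ| ≤ (3d+4)·O(1)·e·p(e)`: the square of this rotation angle is the
printed error `O(1)e²p²(e)` of (4.7)/(1.22). [cite: Balaban1983RegularityDecay, p. 574 (1.21)–(1.22), p. 590 (4.7)] -/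
theorem abs_loopSum_le {n : ℕ} (hn : 1 ≤ n) {Ωc : Finset (Fin (d + 1) → ℤ)}
    {Ac : (Fin (d + 1) → ℤ) → Fin (d + 1) → ℝ} {δ : ℝ} (hδ : 0 ≤ δ)
    (h121 : ∀ x ∈ fineDom n Ωc, ∀ μ ν : Fin (d + 1), |Ac (x + e1 μ) ν - Ac x ν| ≤ δ)
    {x y : Fin (d + 1) → ℤ} (hx : blk n x = y) (hy : y ∈ Ωc) {μ : Fin (d + 1)} (hy' : y + e1 μ ∈ Ωc) :
    |loopSum Ac n y μ x| ≤ (3 * d + 4) * n ^ 2 * δ := by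
  have h1 := abs_stairSum_shift_sub_le hn hδ h121 hx hy hy'
  have h2 := abs_segSum_sub_le hn hδ h121 hx hy hy'
  have hre : loopSum Ac n y μ x = (segSum Ac μ (base n y) n - segSum Ac μ x n)
      + (stairSum Ac n (y + e1 μ) (x + n • e1 μ) - stairSum Ac n y x) := by
    rw [loopSum]; ring
  rw [hre]
  calc _ ≤ |segSum Ac μ (base n y) n - segSum Ac μ x n|
          + |stairSum Ac n (y + e1 μ) (x + n • e1 μ) - stairSum Ac n y x| := abs_add_le _ _
    _ ≤ (2 * d + 3) * n * (n * δ) + (d + 1) * n * (n * δ) := add_le_add h2 h1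
    _ = (3 * d + 4) * n ^ 2 * δ := by ring

end Lattice

end

end Literature.MathematicalPhysics.QuantumFieldTheory.Balaban1983to89.B4Prop31Holonomy
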